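import Literature.NumberTheory.LFunctions.NymanBeurlingDirichlet
import Literature.Analysis.SpecialFunctions.InvSqAddSqIntegral
import HarnessLib

/-!
# Splittings / NB — sharp zero floor, part 1: kernel mass and the regularised test function

Cell rh-split, seat rh-split-nb-neg g3 (card `SPLIT-nb-neg.md` §9, target T1 of the g0 card,
booked by the lead as T7 `NikolskiFloor`); filed by rh-split-typer-1 g3 as the first of two files
(the seat's `NbSharpFloor.lean` 17e3cb5c498f7b16 split at its §2/§3 boundary for the 400-line cap;
imports reduced to `Literature.*` — no route file in the import cone).  Family NB, integrand
`I(N,a) = ∫⁻ ‖1 - ζ(1/2+it) Σ_{k<N} a_k (k+1)^{-(1/2+it)}‖² dt/(1/4+t²)` verbatim as in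
`Literature.NumberTheory.LFunctions.NymanBeurlingDirichlet`.

Contents (all RH-free, no definitions — the test function is spelled out):

* §1 `integral_inv_sq_add_sq_le` (the exact Poisson mass `∫ dt/(δ²+(t-γ)²) = π/δ`, cited from the
  librarian leaf `Literature.Analysis.SpecialFunctions.InvSqAddSqIntegral`), `norm_sq_line_sub`,
  `weight_norm_le_one` (the regularised Blaschke weight `s R²/((s+1)(s+R)²)` has modulus `≤ 1` on the
  critical line), `lintegral_weightedKernel_sq_le` (`∫ ‖w_R(s)/(s-ρ)‖² dt ≤ π/(Re ρ - 1/2)`);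
* §2 the test function `F_R(s) = (s-1-ζ₁(s)A(s)) R²/(s(s+1)(s+R)²)`: holomorphy on `Re s > 0`
  (`differentiableOn_testR`), its value at a zero (`testR_apply_self`), the growth bound the contour
  lemma `ofReal_norm_le_lintegral_line` wants (`norm_testR_le`), and its critical-line factorisation
  (`enorm_testR_div_line`).

Part 2 (`Splittings/NbSharpFloor.lean`) assembles these into the floor
`4π(Re ρ-1/2)‖ρ-1‖²/(‖ρ‖²‖ρ+1‖²) ≤ I(N,a)` of the right order (Nikolski 1995, Thm 0.1).
References: A. Beurling, Proc. Nat. Acad. Sci. 41 (1955) 312–314 (easy half); N. Nikolski, Ann.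
Inst. Fourier 45 (1995) 143–159, Thm 0.1.

HONEST LABEL: «SPLITTING SEARCH over kernel-typed RH-EQUIVALENCES; a splitting A ∧ B ⟹ RH is
CONDITIONAL bookkeeping unless A and B are both proved; nothing here bears on the truth of RH.»
-/

noncomputable section

-- D-0017: `Summit.<S>.<S>.…` is the designed namespace of a single-problem summit.
set_option linter.dupNamespace false

open Complex MeasureTheory Set Filter Topology
open scoped Real ENNReal

namespace Summit.RiemannHypothesis.RiemannHypothesis.Theorems.Splittings.NbSharpFloor

open Literature.NumberTheory.LFunctions

/-! ## 1. The exact Poisson mass of the Cauchy kernel on the critical line -/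

/-- `∫_ℝ dt/(δ² + (t-γ)²) ≤ π/δ` for `δ > 0` (in fact equality), with integrability — the translate
`(δ² + (-γ+t)²)⁻¹` of the librarian leaf `Literature.Analysis.SpecialFunctions.InvSqAddSqIntegral`
(`integrable_inv_sq_add_add_sq_of_ne_zero`, `integral_inv_sq_add_add_sq_eq_pi_div`). [folklore] -/
theorem integral_inv_sq_add_sq_le {δ : ℝ} (hδ : 0 < δ) (γ : ℝ) :
    Integrable (fun t : ℝ ↦ (δ ^ 2 + (t - γ) ^ 2)⁻¹) ∧
      ∫ t : ℝ, (δ ^ 2 + (t - γ) ^ 2)⁻¹ ≤ π / δ := by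
  have hrepr : (fun t : ℝ ↦ (δ ^ 2 + (t - γ) ^ 2)⁻¹) = fun t ↦ (δ ^ 2 + (-γ + t) ^ 2)⁻¹ := by
    funext t
    rw [neg_add_eq_sub]
  rw [hrepr]
  exact ⟨Literature.Analysis.SpecialFunctions.integrable_inv_sq_add_add_sq_of_ne_zero hδ.ne' (-γ),
    (Literature.Analysis.SpecialFunctions.integral_inv_sq_add_add_sq_eq_pi_div hδ (-γ)).le⟩

/-- `‖1/2 + it - ρ‖² = (Re ρ - 1/2)² + (t - Im ρ)²`. [folklore] -/
theorem norm_sq_line_sub (ρ : ℂ) (t : ℝ) :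
    ‖(1 / 2 : ℂ) + t * I - ρ‖ ^ 2 = (ρ.re - 1 / 2) ^ 2 + (t - ρ.im) ^ 2 := by
  rw [Complex.sq_norm, Complex.normSq_apply]
  simp
  ring

/-- **The regularised Blaschke weight is bounded by one on the critical line.** For `s = 1/2+it`,
`R > 0`: `‖s R² / ((s+1)(s+R)²)‖ ≤ 1` (`‖s‖ ≤ ‖s+1‖`, `R ≤ ‖s+R‖`). [folklore] -/
theorem weight_norm_le_one {R : ℝ} (hR : 0 < R) (t : ℝ) :
    ‖((1 / 2 : ℂ) + t * I) * (R : ℂ) ^ 2 / (((1 / 2 : ℂ) + t * I + 1) * ((1 / 2 : ℂ) + t * I + R) ^ 2)‖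
      ≤ 1 := by
  set s : ℂ := 1 / 2 + t * I with hs
  have h1 : ‖s‖ ≤ ‖s + 1‖ := by
    have h : ‖s‖ ^ 2 ≤ ‖s + 1‖ ^ 2 := by
      rw [Complex.sq_norm, Complex.sq_norm, Complex.normSq_apply, Complex.normSq_apply, hs]
      simp
      nlinarith
    exact le_of_pow_le_pow_left₀ two_ne_zero (norm_nonneg _) h
  have h2 : R ^ 2 ≤ ‖s + R‖ ^ 2 := by
    rw [Complex.sq_norm, Complex.normSq_apply, hs]
    simp
    nlinarith [mul_self_nonneg t]
  have h3 : 0 < ‖s + 1‖ := by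
    refine norm_pos_iff.mpr fun h ↦ ?_
    have := congrArg Complex.re h
    rw [hs] at this
    norm_num at this
  have h4 : 0 < ‖s + R‖ := by
    refine norm_pos_iff.mpr fun h ↦ ?_
    have := congrArg Complex.re h
    rw [hs] at this
    simp at this
    linarith
  rw [norm_div, norm_mul, norm_mul, norm_pow, norm_pow, Complex.norm_real, Real.norm_of_nonneg hR.le,
    div_le_one (by positivity)]
  exact mul_le_mul h1 h2 (by positivity) (norm_nonneg _)

/-- **Poisson mass of the weighted Cauchy kernel.** For `Re ρ > 1/2` and `R > 0`,
`∫_ℝ ‖s R²/((s+1)(s+R)²(s-ρ))‖² dt ≤ π/(Re ρ - 1/2)`, `s = 1/2+it`. [folklore] -/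
theorem lintegral_weightedKernel_sq_le {ρ : ℂ} (hρ : 1 / 2 < ρ.re) {R : ℝ} (hR : 0 < R) :
    ∫⁻ t : ℝ, ‖((1 / 2 : ℂ) + t * I) * (R : ℂ) ^ 2 /
        (((1 / 2 : ℂ) + t * I + 1) * ((1 / 2 : ℂ) + t * I + R) ^ 2) / (1 / 2 + t * I - ρ)‖ₑ ^ (2 : ℝ) ≤
      ENNReal.ofReal (π / (ρ.re - 1 / 2)) := by
  set δ := ρ.re - 1 / 2 with hδ
  have hδ0 : 0 < δ := by rw [hδ]; linarith
  have hbound : ∀ t : ℝ, ‖((1 / 2 : ℂ) + t * I) * (R : ℂ) ^ 2 /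
      (((1 / 2 : ℂ) + t * I + 1) * ((1 / 2 : ℂ) + t * I + R) ^ 2) / (1 / 2 + t * I - ρ)‖ ^ 2 ≤
      (δ ^ 2 + (t - ρ.im) ^ 2)⁻¹ := by
    intro t
    have hw := weight_norm_le_one hR t
    have hn : ‖(1 / 2 : ℂ) + t * I - ρ‖ ^ 2 = δ ^ 2 + (t - ρ.im) ^ 2 := by
      rw [norm_sq_line_sub, hδ]
    have hpos : 0 < δ ^ 2 + (t - ρ.im) ^ 2 := by positivity
    rw [norm_div, div_pow]
    calc ‖((1 / 2 : ℂ) + t * I) * (R : ℂ) ^ 2 /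
          (((1 / 2 : ℂ) + t * I + 1) * ((1 / 2 : ℂ) + t * I + R) ^ 2)‖ ^ 2 /
          ‖(1 / 2 : ℂ) + t * I - ρ‖ ^ 2
        ≤ 1 ^ 2 / ‖(1 / 2 : ℂ) + t * I - ρ‖ ^ 2 := by
          gcongr
      _ = (δ ^ 2 + (t - ρ.im) ^ 2)⁻¹ := by rw [one_pow, hn, one_div]
  obtain ⟨hint, hle⟩ := integral_inv_sq_add_sq_le hδ0 ρ.im
  calc ∫⁻ t : ℝ, ‖((1 / 2 : ℂ) + t * I) * (R : ℂ) ^ 2 /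
        (((1 / 2 : ℂ) + t * I + 1) * ((1 / 2 : ℂ) + t * I + R) ^ 2) / (1 / 2 + t * I - ρ)‖ₑ ^ (2 : ℝ)
      ≤ ∫⁻ t : ℝ, ENNReal.ofReal ((δ ^ 2 + (t - ρ.im) ^ 2)⁻¹) := by
        refine lintegral_mono fun t ↦ ?_
        rw [ENNReal.rpow_two, ← ofReal_norm, ← ENNReal.ofReal_pow (norm_nonneg _)]
        exact ENNReal.ofReal_le_ofReal (hbound t)
    _ = ENNReal.ofReal (∫ t : ℝ, (δ ^ 2 + (t - ρ.im) ^ 2)⁻¹) := by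
        rw [ofReal_integral_eq_lintegral_ofReal hint]
        exact Eventually.of_forall fun t ↦ by positivity
    _ ≤ ENNReal.ofReal (π / (ρ.re - 1 / 2)) := ENNReal.ofReal_le_ofReal hle

/-! ## 2. The regularised test function `F_R(s) = (s-1-ζ₁(s)A(s)) R²/(s(s+1)(s+R)²)` -/

/-- `F_R` is holomorphic on `Re s > 0` (no definition: the function is spelled out). [folklore] -/
theorem differentiableOn_testR (R : ℝ) (hR : 0 < R) {N : ℕ} (a : Fin N → ℂ) :
    DifferentiableOn ℂ (fun s : ℂ ↦ (s - 1 - riemannZeta₁ s * dirichletPoly a s) *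
      ((R : ℂ) ^ 2 / ((s + 1) * (s + R) ^ 2)) / s) {s : ℂ | 0 < s.re} := by
  have h1 : Differentiable ℂ fun s ↦ s - 1 - riemannZeta₁ s * dirichletPoly a s :=
    (differentiable_id.sub_const 1).sub
      (differentiable_riemannZeta₁.mul (differentiable_dirichletPoly a))
  refine DifferentiableOn.div ?_ differentiableOn_id ?_
  · refine h1.differentiableOn.mul ?_
    refine DifferentiableOn.div (differentiableOn_const _)
      ((differentiableOn_id.add_const 1).mul ((differentiableOn_id.add_const _).pow 2)) ?_
    intro s hs h
    have hs' : 0 < s.re := hs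
    rcases mul_eq_zero.mp h with h' | h'
    · have : (s + 1).re = 0 := by rw [h']; simp
      simp at this; linarith
    · have h'' : s + R = 0 := pow_eq_zero_iff (n := 2) (by norm_num) |>.mp h'
      have : (s + R).re = 0 := by rw [h'']; simp
      simp at this; linarith
  · intro s hs h
    have hs' : 0 < s.re := hs
    rw [h] at hs'; simp at hs'

/-- At a zero `ρ` of `ζ` (`ρ ≠ 1`), `F_R(ρ) = (ρ-1) R²/(ρ(ρ+1)(ρ+R)²)`, independently of the Dirichlet
polynomial. [folklore] -/
theorem testR_apply_self {ρ : ℂ} (hζ : riemannZeta ρ = 0) (hρ1 : ρ ≠ 1) (R : ℝ)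
    {N : ℕ} (a : Fin N → ℂ) :
    (fun s : ℂ ↦ (s - 1 - riemannZeta₁ s * dirichletPoly a s) *
      ((R : ℂ) ^ 2 / ((s + 1) * (s + R) ^ 2)) / s) ρ =
      (ρ - 1) * ((R : ℂ) ^ 2 / ((ρ + 1) * (ρ + R) ^ 2)) / ρ := by
  have hz : riemannZeta₁ ρ = 0 := by
    have h := riemannZeta_eq_inv_sub_mul hρ1
    rw [hζ] at h
    have hne : (ρ - 1)⁻¹ ≠ 0 := inv_ne_zero (sub_ne_zero.mpr hρ1)
    exact (mul_eq_zero.mp h.symm).resolve_left hne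
  simp only [hz, zero_mul, sub_zero]

/-- Growth of `F_R`: `‖F_R(s)‖ ≤ (2 + 5 Σ‖a_n‖) R² / ‖s‖` for `Re s ≥ 1/2`, `‖s‖ ≥ 1` (Titchmarsh
(2.12.2) in the form `‖ζ₁(s)‖ ≤ 5‖s‖²`, and `‖s+1‖, ‖s+R‖ ≥ ‖s‖`). [folklore] -/
theorem norm_testR_le {R : ℝ} (hR : 0 < R) {N : ℕ} (a : Fin N → ℂ) {s : ℂ} (hs : 1 / 2 ≤ s.re)
    (h1 : 1 ≤ ‖s‖) :
    ‖(fun s : ℂ ↦ (s - 1 - riemannZeta₁ s * dirichletPoly a s) *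
      ((R : ℂ) ^ 2 / ((s + 1) * (s + R) ^ 2)) / s) s‖ ≤ (2 + 5 * ∑ n : Fin N, ‖a n‖) * R ^ 2 / ‖s‖ := by
  set M := ∑ n : Fin N, ‖a n‖ with hM
  have hM0 : 0 ≤ M := Finset.sum_nonneg fun n _ ↦ norm_nonneg _
  have hs0 : 0 < s.re := by linarith
  have hsn : 0 < ‖s‖ := by linarith
  -- ‖ζ₁ s‖ ≤ 5 ‖s‖²
  have hζ : ‖riemannZeta₁ s‖ ≤ 5 * ‖s‖ ^ 2 := by
    have h := norm_riemannZeta₁_le_of_re_pos hs0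
    have hs1 : ‖s - 1‖ ≤ 2 * ‖s‖ := by
      calc ‖s - 1‖ ≤ ‖s‖ + ‖(1 : ℂ)‖ := norm_sub_le _ _
        _ = ‖s‖ + 1 := by simp
        _ ≤ 2 * ‖s‖ := by linarith
    have hdiv : ‖s‖ * ‖s - 1‖ / s.re ≤ ‖s‖ * ‖s - 1‖ / (1 / 2) :=
      div_le_div_of_nonneg_left (by positivity) (by norm_num) hs
    calc ‖riemannZeta₁ s‖ ≤ ‖s‖ + ‖s‖ * ‖s - 1‖ / s.re := h
      _ ≤ ‖s‖ + ‖s‖ * ‖s - 1‖ / (1 / 2) := by linarith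
      _ = ‖s‖ + 2 * (‖s‖ * ‖s - 1‖) := by ring
      _ ≤ ‖s‖ * ‖s‖ + 2 * (‖s‖ * (2 * ‖s‖)) := by gcongr; nlinarith
      _ = 5 * ‖s‖ ^ 2 := by ring
  have hA : ‖dirichletPoly a s‖ ≤ M := norm_dirichletPoly_le a hs0.le
  have hnum : ‖s - 1 - riemannZeta₁ s * dirichletPoly a s‖ ≤ (2 + 5 * M) * ‖s‖ ^ 2 := by
    calc ‖s - 1 - riemannZeta₁ s * dirichletPoly a s‖
        ≤ ‖s - 1‖ + ‖riemannZeta₁ s * dirichletPoly a s‖ := norm_sub_le _ _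
      _ ≤ (‖s‖ + 1) + ‖riemannZeta₁ s‖ * ‖dirichletPoly a s‖ := by
          rw [norm_mul]; gcongr
          calc ‖s - 1‖ ≤ ‖s‖ + ‖(1 : ℂ)‖ := norm_sub_le _ _
            _ = ‖s‖ + 1 := by simp
      _ ≤ 2 * ‖s‖ ^ 2 + 5 * ‖s‖ ^ 2 * M := by
          gcongr ?_ + ?_
          · nlinarith
          · calc ‖riemannZeta₁ s‖ * ‖dirichletPoly a s‖ ≤ 5 * ‖s‖ ^ 2 * M := by gcongr
              _ = 5 * ‖s‖ ^ 2 * M := rfl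
      _ = (2 + 5 * M) * ‖s‖ ^ 2 := by ring
  -- ‖s‖ ≤ ‖s + 1‖ and ‖s‖ ≤ ‖s + R‖ since Re s > 0
  have hs1 : ‖s‖ ≤ ‖s + 1‖ := by
    have h2 : ‖s‖ ^ 2 ≤ ‖s + 1‖ ^ 2 := by
      rw [Complex.sq_norm, Complex.sq_norm, Complex.normSq_apply, Complex.normSq_apply]
      simp
      nlinarith
    exact le_of_pow_le_pow_left₀ two_ne_zero (norm_nonneg _) h2
  have hsR : ‖s‖ ≤ ‖s + R‖ := by
    have h2 : ‖s‖ ^ 2 ≤ ‖s + R‖ ^ 2 := by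
      rw [Complex.sq_norm, Complex.sq_norm, Complex.normSq_apply, Complex.normSq_apply]
      simp
      nlinarith
    exact le_of_pow_le_pow_left₀ two_ne_zero (norm_nonneg _) h2
  have hK : ‖(R : ℂ) ^ 2 / ((s + 1) * (s + R) ^ 2)‖ ≤ R ^ 2 / ‖s‖ ^ 3 := by
    rw [norm_div, norm_mul, norm_pow, norm_pow, Complex.norm_real, Real.norm_of_nonneg hR.le]
    refine div_le_div_of_nonneg_left (by positivity) (by positivity) ?_
    calc ‖s‖ ^ 3 = ‖s‖ * ‖s‖ ^ 2 := by ring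
      _ ≤ ‖s + 1‖ * ‖s + R‖ ^ 2 := by gcongr
  simp only []
  rw [norm_div, norm_mul]
  calc ‖s - 1 - riemannZeta₁ s * dirichletPoly a s‖ * ‖(R : ℂ) ^ 2 / ((s + 1) * (s + R) ^ 2)‖ / ‖s‖
      ≤ (2 + 5 * M) * ‖s‖ ^ 2 * (R ^ 2 / ‖s‖ ^ 3) / ‖s‖ := by gcongr
    _ = (2 + 5 * M) * R ^ 2 / ‖s‖ ^ 2 := by field_simp
    _ ≤ (2 + 5 * M) * R ^ 2 / ‖s‖ := by
        refine div_le_div_of_nonneg_left (by positivity) hsn ?_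
        nlinarith

/-- On the critical line, `‖F_R(s)/(s-ρ)‖ = (‖1 - ζ(s)A(s)‖/‖s‖) · ‖s R²/((s+1)(s+R)²(s-ρ))‖`
(`ζ₁ = (s-1)ζ`, `‖s-1‖ = ‖s‖`). [folklore] -/
theorem enorm_testR_div_line (ρ : ℂ) (R : ℝ) {N : ℕ} (a : Fin N → ℂ) (t : ℝ) :
    ‖(fun s : ℂ ↦ (s - 1 - riemannZeta₁ s * dirichletPoly a s) *
      ((R : ℂ) ^ 2 / ((s + 1) * (s + R) ^ 2)) / s) (1 / 2 + t * I) / (1 / 2 + t * I - ρ)‖ₑ =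
      ENNReal.ofReal (‖1 - riemannZeta (1 / 2 + t * I) * dirichletPoly a (1 / 2 + t * I)‖ /
          ‖(1 / 2 : ℂ) + t * I‖) *
        ‖((1 / 2 : ℂ) + t * I) * (R : ℂ) ^ 2 /
          (((1 / 2 : ℂ) + t * I + 1) * ((1 / 2 : ℂ) + t * I + R) ^ 2) / (1 / 2 + t * I - ρ)‖ₑ := by
  set s : ℂ := 1 / 2 + t * I with hs
  have hs1 : s ≠ 1 := one_half_add_ne_one t
  have hs0 : s ≠ 0 := norm_pos_iff.mp (norm_one_half_add_pos t)
  have hζ₁ : riemannZeta₁ s = (s - 1) * riemannZeta s := by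
    rw [riemannZeta_eq_inv_sub_mul hs1]; field_simp [sub_ne_zero.mpr hs1]
  have hfac : (s - 1 - riemannZeta₁ s * dirichletPoly a s) *
      ((R : ℂ) ^ 2 / ((s + 1) * (s + R) ^ 2)) / s / (s - ρ) =
      ((s - 1) * (1 - riemannZeta s * dirichletPoly a s) / s ^ 2) *
        (s * (R : ℂ) ^ 2 / ((s + 1) * (s + R) ^ 2) / (s - ρ)) := by
    rw [hζ₁]
    field_simp
  simp only []
  rw [hfac, enorm_mul, ← ofReal_norm]
  congr 1
  rw [norm_div, norm_mul, norm_pow, hs, norm_one_half_add_sub_one t, ← hs]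
  have hpos : 0 < ‖s‖ := norm_one_half_add_pos t
  congr 1
  field_simp


end Summit.RiemannHypothesis.RiemannHypothesis.Theorems.Splittings.NbSharpFloor

end
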